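import Literature.AlgebraicGeometry.Frobenioids.ModelFrobenioidPreFrobenioid
import Literature.AlgebraicGeometry.Frobenioids.ModelFrobenioidFunctorIso
import HarnessLib

/-!
# Frobenioids I, Thm. 5.2 / Cor. 5.4: rigidity of functors into a model Frobenioid — two functors over the
# same base functor agreeing on Frobenius degrees, divisors AND units are isomorphic

Mochizuki, *The geometry of Frobenioids I: the general theory*, Kyushu J. Math. **62** (2008)
293–400, §5, Theorem 5.2 (i) p. 100 (a morphism of the model Frobenioid of `(Φ, B, Div_B)` IS the
quadruple `(deg_Fr, Base, Div, u)` subject to relation (d)), Theorem 5.2 (iv) pp. 101–103 (the comparison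
functor is pinned entry by entry: "this is immediate for the first three entries of the data that define a
morphism […]; for the final entry, it follows from the existence of the unique factorizations") and
Corollary 5.4 p. 104 [cite: MochizukiFrdI2008, Thm. 5.2 p.100]; consumer locus [IUTchI] Cor. 5.3 (ii)/(iv)
p. 144 ("is bijective", "is injective") [cite: Mochizuki2012, Cor. 5.3 p.144].

PROOF-ONLY sequel to `ModelFrobenioidSelfEquivalenceRigidity.lean` (abc-iut row «C53/S2b TWO-FUNCTOR
RIGIDITY», this file abc-iut-L1-t7; L1 census row C54 device of abc-iut-L1-t10
`ModelFrobenioid.nonempty_iso_of_agree`, `ModelFrobenioidFunctorIso.lean`).  THE THEOREM: let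
`M₁ = ModelFrobenioid Φ₁ B₁ Div_{B₁}` on `D₁`, `M₂ = ModelFrobenioid Φ₂ B₂ Div_{B₂}` on `D₂` (NO hypothesis
on the data — in particular `Div_{B₂}` need not be injective nor `B₂` group-like, which is what
`nonempty_iso_of_agree` assumes), `G₁ G₂ : M₁ ⥤ M₂` two functors preserving Frobenius degrees, `G₁` lying
over a base functor `H : D₁ ⥤ D₂` through a natural family `a_X : Base(G₁ X) ⥲ H(Base X)`, and
`b_X : Base(G₁ X) ⥲ Base(G₂ X)` a natural base identification through which `G₁`, `G₂` AGREE ON DIVISORS AND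
ON UNITS: `Div(G₁ f) = b_X^* Div(G₂ f)`, `u_{G₁ f} = b_X^* u_{G₂ f}`.  Then `G₁ ≅ G₂` by an isomorphism with
components `(1, b_X, 0, 1)` (`exists_iso_of_agree_unit`).  The case `M₁ = M₂`, `G₂ = 𝟭`, `H = 𝟭` is the
self-equivalence rigidity of the parent file; the present form is the one "`Isom(¹ℱ, ²ℱ) → Isom(¹𝒟, ²𝒟)` is
injective" consumes for two DIFFERENT Frobenioids without passing through `β⁻¹ ∘ α`.

THE ARGUMENT is that of the parent file with the discrepancy `c_X := cls(G₁ X) − b_X^* cls(G₂ X)`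
transported to `Φ₂(H(Base X))^gp` along `a_X`: relation (d) for `G₁ f` and for `G₂ f` give
`deg_Fr(f) · c_X = Base(G₁ f)^* c_Y` (`funDiscr_pow_eq`), hence `deg_Fr(f) · ĉ_X = H(Base f)^* ĉ_Y` for
`ĉ_X := (a_X⁻¹)^* c_X` (`funDiscrH_pow_eq`); pre-steps make `ĉ` constant on fibres, the degree-`2` Frobenius
morphism `(2, id, 0, 1)` gives `2 ĉ = ĉ`, so `ĉ = 0`, `c = 0`, `cls(G₁ X) = b_X^* cls(G₂ X)`
(`cls_obj_eq_pullGp_of_agree_unit`).  No statement of either paper is restated as a fact; nothing here bears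
on [IUTchIII] Cor. 3.12; a theorem about OUR model categories.
-/

namespace Literature.AlgebraicGeometry.Frobenioids

open CategoryTheory Opposite

universe w₁ w₂ v₁ v₂ u₁ u₂

namespace ModelFrobenioid

/-- Dividing two instances of relation (d) with the same divisor and unit terms: from
`x ^ d · z = a · s` and `p ^ d · z = q · s` in a commutative group, `(x / p) ^ d = a / q`. [folklore] -/
private theorem div_pow_eq_of_two_rels' {G : Type*} [CommGroup G] {x p z a q s : G} {d : ℕ}
    (h₁ : x ^ d * z = a * s) (h₂ : p ^ d * z = q * s) : (x / p) ^ d = a / q := by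
  rw [div_pow, eq_mul_inv_of_mul_eq h₁, eq_mul_inv_of_mul_eq h₂, mul_div_mul_right_eq_div,
    mul_div_mul_right_eq_div]

variable {D₁ : Type u₁} [Category.{v₁} D₁] {D₂ : Type u₂} [Category.{v₂} D₂]
  {Φ₁ B₁ : D₁ᵒᵖ ⥤ CommMonCat.{w₁}} {DivB₁ : B₁ ⟶ monoidGp Φ₁}
  {Φ₂ B₂ : D₂ᵒᵖ ⥤ CommMonCat.{w₂}} {DivB₂ : B₂ ⟶ monoidGp Φ₂}
  {H : D₁ ⥤ D₂} {G₁ G₂ : ModelFrobenioid Φ₁ B₁ DivB₁ ⥤ ModelFrobenioid Φ₂ B₂ DivB₂}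
  (a : ∀ X : ModelFrobenioid Φ₁ B₁ DivB₁, (G₁.obj X).base ≅ H.obj X.base)
  (han : ∀ ⦃X Y : ModelFrobenioid Φ₁ B₁ DivB₁⦄ (f : X ⟶ Y),
    baseMap (G₁.map f) ≫ (a Y).hom = (a X).hom ≫ H.map (baseMap f))
  (b : ∀ X : ModelFrobenioid Φ₁ B₁ DivB₁, (G₁.obj X).base ≅ (G₂.obj X).base)
  (hbn : ∀ ⦃X Y : ModelFrobenioid Φ₁ B₁ DivB₁⦄ (f : X ⟶ Y),
    baseMap (G₁.map f) ≫ (b Y).hom = (b X).hom ≫ baseMap (G₂.map f))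
  (hdeg₁ : ∀ ⦃X Y : ModelFrobenioid Φ₁ B₁ DivB₁⦄ (f : X ⟶ Y), degFr (G₁.map f) = degFr f)
  (hdeg₂ : ∀ ⦃X Y : ModelFrobenioid Φ₁ B₁ DivB₁⦄ (f : X ⟶ Y), degFr (G₂.map f) = degFr f)
  (hdiv : ∀ ⦃X Y : ModelFrobenioid Φ₁ B₁ DivB₁⦄ (f : X ⟶ Y),
    div (G₁.map f) = pull Φ₂ (b X).hom (div (G₂.map f)))
  (hunit : ∀ ⦃X Y : ModelFrobenioid Φ₁ B₁ DivB₁⦄ (f : X ⟶ Y),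
    unit (G₁.map f) = pull B₂ (b X).hom (unit (G₂.map f)))

section Discrepancy

include han in
/-- Naturality of `a_X⁻¹ : H(Base X) ⥲ Base(G₁ X)`. [cite: MochizukiFrdI2008, Cor. 5.4 p.104] -/
theorem overIso_inv_naturality {X Y : ModelFrobenioid Φ₁ B₁ DivB₁} (f : X ⟶ Y) :
    H.map (baseMap f) ≫ (a Y).inv = (a X).inv ≫ baseMap (G₁.map f) := by
  rw [Iso.comp_inv_eq, Category.assoc, Iso.eq_inv_comp]
  exact (han f).symm

include hbn hdeg₁ hdeg₂ hdiv hunit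

/-- **The discrepancy law**: for `c_X := cls(G₁ X) − b_X^* cls(G₂ X) ∈ Φ₂(Base G₁ X)^gp` and every morphism
`f : X → Y` of `M₁`, `deg_Fr(f) · c_X = Base(G₁ f)^* c_Y` — relation (d) for `G₁ f` minus relation (d) for
`G₂ f` pulled back along `b`, the divisor and unit terms cancelling by `hdiv`, `hunit`.
[cite: MochizukiFrdI2008, Thm. 5.2(iv) p.102] -/
theorem funDiscr_pow_eq {X Y : ModelFrobenioid Φ₁ B₁ DivB₁} (f : X ⟶ Y) :
    ((G₁.obj X).cls / pullGp Φ₂ (b X).hom (G₂.obj X).cls) ^ (degFr f : ℕ) =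
      pullGp Φ₂ (baseMap (G₁.map f)) ((G₁.obj Y).cls / pullGp Φ₂ (b Y).hom (G₂.obj Y).cls) := by
  have h₁ := rel (G₁.map f)
  rw [hdeg₁] at h₁
  have h₂ := rel_pulled b hbn hdeg₂ hdiv f
  have hu : (B₂.map (b X).hom.op).hom (unit (G₂.map f)) = unit (G₁.map f) := (hunit f).symm
  rw [hu] at h₂
  rw [map_div]
  exact div_pow_eq_of_two_rels' h₁ h₂

include han

/-- The discrepancy law transported to `H`: for `ĉ_X := (a_X⁻¹)^* c_X ∈ Φ₂(H(Base X))^gp`,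
`deg_Fr(f) · ĉ_X = H(Base f)^* ĉ_Y`. [cite: MochizukiFrdI2008, Thm. 5.2(iv) p.102] -/
theorem funDiscrH_pow_eq {X Y : ModelFrobenioid Φ₁ B₁ DivB₁} (f : X ⟶ Y) :
    pullGp Φ₂ (a X).inv ((G₁.obj X).cls / pullGp Φ₂ (b X).hom (G₂.obj X).cls) ^ (degFr f : ℕ) =
      pullGp Φ₂ (H.map (baseMap f))
        (pullGp Φ₂ (a Y).inv ((G₁.obj Y).cls / pullGp Φ₂ (b Y).hom (G₂.obj Y).cls)) := by
  rw [← map_pow, funDiscr_pow_eq b hbn hdeg₁ hdeg₂ hdiv hunit f, ← pullGp_comp, ← pullGp_comp,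
    overIso_inv_naturality a han f]

/-- `ĉ` is unchanged along the pre-step `(1, id, z, 1) : (A, α) → (A, α + z)`.
[cite: MochizukiFrdI2008, Thm. 5.2(iv) p.102] -/
theorem funDiscrH_eq_of_mul_of (A : D₁) (α : Algebra.GrothendieckGroup (Φ₁.obj (op A)))
    (z : Φ₁.obj (op A)) :
    pullGp Φ₂ (a ⟨A, α⟩).inv ((G₁.obj ⟨A, α⟩).cls / pullGp Φ₂ (b ⟨A, α⟩).hom (G₂.obj ⟨A, α⟩).cls) =
      pullGp Φ₂ (a ⟨A, α * Algebra.GrothendieckGroup.of z⟩).inv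
        ((G₁.obj ⟨A, α * Algebra.GrothendieckGroup.of z⟩).cls /
          pullGp Φ₂ (b ⟨A, α * Algebra.GrothendieckGroup.of z⟩).hom
            (G₂.obj ⟨A, α * Algebra.GrothendieckGroup.of z⟩).cls) := by
  -- the pre-step `(1, id, z, 1) : (A, α) → (A, α + z)`
  let s : (⟨A, α⟩ : ModelFrobenioid Φ₁ B₁ DivB₁) ⟶ ⟨A, α * Algebra.GrothendieckGroup.of z⟩ :=
    { degFr := 1
      base := 𝟙 A
      div := z
      unit := 1
      rel := by
        show α ^ ((1 : ℕ+) : ℕ) * _ = pullGp Φ₁ (𝟙 A) (α * Algebra.GrothendieckGroup.of z) * _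
        rw [PNat.one_coe, pow_one, pullGp_id, map_one, mul_one] }
  have h := funDiscrH_pow_eq a han b hbn hdeg₁ hdeg₂ hdiv hunit s
  rw [show degFr s = 1 from rfl, PNat.one_coe, pow_one, show baseMap s = 𝟙 A from rfl, H.map_id,
    pullGp_id] at h
  exact h

/-- `ĉ` is doubled along the degree-`2` Frobenius morphism `(2, id, 0, 1) : (A, α) → (A, 2α)`:
`2 · ĉ_{(A, α)} = ĉ_{(A, 2α)}`. [cite: MochizukiFrdI2008, Thm. 5.2(iii) p.101] -/
theorem funDiscrH_sq_eq_of_frobenius (A : D₁) (α : Algebra.GrothendieckGroup (Φ₁.obj (op A))) :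
    pullGp Φ₂ (a ⟨A, α⟩).inv ((G₁.obj ⟨A, α⟩).cls / pullGp Φ₂ (b ⟨A, α⟩).hom (G₂.obj ⟨A, α⟩).cls) ^ 2 =
      pullGp Φ₂ (a ⟨A, α ^ 2⟩).inv
        ((G₁.obj ⟨A, α ^ 2⟩).cls / pullGp Φ₂ (b ⟨A, α ^ 2⟩).hom (G₂.obj ⟨A, α ^ 2⟩).cls) := by
  -- the Frobenius morphism `(2, id, 0, 1) : (A, α) → (A, 2α)`
  let f : (⟨A, α⟩ : ModelFrobenioid Φ₁ B₁ DivB₁) ⟶ ⟨A, α ^ 2⟩ :=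
    { degFr := 2
      base := 𝟙 A
      div := 1
      unit := 1
      rel := by
        show α ^ ((2 : ℕ+) : ℕ) * _ = pullGp Φ₁ (𝟙 A) (α ^ 2) * _
        rw [map_one, mul_one, map_one, mul_one, pullGp_id]
        rfl }
  have h := funDiscrH_pow_eq a han b hbn hdeg₁ hdeg₂ hdiv hunit f
  rw [show degFr f = 2 from rfl, show (((2 : ℕ+) : ℕ)) = 2 from rfl, show baseMap f = 𝟙 A from rfl,
    H.map_id, pullGp_id] at h
  exact h

/-- **`ĉ` is constant on each fibre** `{(A, α)}_{α ∈ Φ₁(A)^gp}`. [cite: MochizukiFrdI2008, Thm. 5.2(iv) p.102] -/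
theorem funDiscrH_eq_of_base_eq (A : D₁) (α β : Algebra.GrothendieckGroup (Φ₁.obj (op A))) :
    pullGp Φ₂ (a ⟨A, α⟩).inv ((G₁.obj ⟨A, α⟩).cls / pullGp Φ₂ (b ⟨A, α⟩).hom (G₂.obj ⟨A, α⟩).cls) =
      pullGp Φ₂ (a ⟨A, β⟩).inv ((G₁.obj ⟨A, β⟩).cls / pullGp Φ₂ (b ⟨A, β⟩).hom (G₂.obj ⟨A, β⟩).cls) := by
  obtain ⟨x, y, hq⟩ := exists_cls_eq_div (⟨A, β / α⟩ : ModelFrobenioid Φ₁ B₁ DivB₁)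
  dsimp only at x y hq
  have hαβ : α * Algebra.GrothendieckGroup.of x = β * Algebra.GrothendieckGroup.of y := by
    rw [div_eq_div_iff_mul_eq_mul] at hq
    rw [mul_comm α, ← hq, mul_comm]
  rw [funDiscrH_eq_of_mul_of a han b hbn hdeg₁ hdeg₂ hdiv hunit A α x,
    funDiscrH_eq_of_mul_of a han b hbn hdeg₁ hdeg₂ hdiv hunit A β y, hαβ]

/-- **The discrepancy vanishes**: `cls(G₁ X) = b_X^* cls(G₂ X)` in `Φ₂(Base G₁ X)^gp`.
[cite: MochizukiFrdI2008, Thm. 5.2(iv) p.102] -/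
theorem cls_obj_eq_pullGp_of_agree_unit (X : ModelFrobenioid Φ₁ B₁ DivB₁) :
    (G₁.obj X).cls = pullGp Φ₂ (b X).hom (G₂.obj X).cls := by
  obtain ⟨A, α⟩ := X
  -- `2 ĉ = ĉ`, hence `ĉ = 1`
  have h2 := funDiscrH_sq_eq_of_frobenius a han b hbn hdeg₁ hdeg₂ hdiv hunit A α
  rw [← funDiscrH_eq_of_base_eq a han b hbn hdeg₁ hdeg₂ hdiv hunit A α (α ^ 2)] at h2
  have h : pullGp Φ₂ (a ⟨A, α⟩).inv
      ((G₁.obj ⟨A, α⟩).cls / pullGp Φ₂ (b ⟨A, α⟩).hom (G₂.obj ⟨A, α⟩).cls) = 1 := by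
    refine mul_left_cancel (a := pullGp Φ₂ (a ⟨A, α⟩).inv
      ((G₁.obj ⟨A, α⟩).cls / pullGp Φ₂ (b ⟨A, α⟩).hom (G₂.obj ⟨A, α⟩).cls)) ?_
    rw [mul_one, ← pow_two]
    exact h2
  -- hence `c = a_X^* ĉ = 1`
  have hc : (G₁.obj ⟨A, α⟩).cls / pullGp Φ₂ (b ⟨A, α⟩).hom (G₂.obj ⟨A, α⟩).cls = 1 := by
    have h' := congrArg (pullGp Φ₂ (a ⟨A, α⟩).hom) h
    rwa [← pullGp_comp, Iso.hom_inv_id, pullGp_id, map_one] at h'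
  exact div_eq_one.mp hc

end Discrepancy

section Rigidity

include hbn hdeg₁ hdeg₂ hdiv hunit han

/-- **Rigidity of functors into a model Frobenioid, two-functor form.**  Two functors
`G₁ G₂ : M₁ ⥤ M₂` between model Frobenioids, preserving Frobenius degrees, `G₁` lying over a base functor
`H` (natural family `a_X : Base(G₁ X) ⥲ H(Base X)`), identified on bases by a natural family
`b_X : Base(G₁ X) ⥲ Base(G₂ X)` through which they agree on divisors (`Div(G₁ f) = b_X^* Div(G₂ f)`) and on
units (`u_{G₁ f} = b_X^* u_{G₂ f}`), are isomorphic by an isomorphism with components `(1, b_X, 0, 1)` — no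
hypothesis on `(Φ₂, B₂, Div_{B₂})`. [cite: MochizukiFrdI2008, Thm. 5.2(iv) p.102]
[cite: Mochizuki2012, Cor. 5.3 p.144] -/
theorem exists_iso_of_agree_unit :
    ∃ ι : G₁ ≅ G₂, ∀ X : ModelFrobenioid Φ₁ B₁ DivB₁,
      degFr (ι.hom.app X) = 1 ∧ baseMap (ι.hom.app X) = (b X).hom ∧
        div (ι.hom.app X) = 1 ∧ unit (ι.hom.app X) = 1 := by
  have hcls := cls_obj_eq_pullGp_of_agree_unit a han b hbn hdeg₁ hdeg₂ hdiv hunit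
  have hcls' : ∀ X : ModelFrobenioid Φ₁ B₁ DivB₁,
      (G₂.obj X).cls = pullGp Φ₂ (b X).inv (G₁.obj X).cls := fun X => by
    rw [hcls X, ← pullGp_comp, Iso.inv_hom_id, pullGp_id]
  -- the components `(1, b_X, 0, 1) : G₁ X → G₂ X` and their inverses `(1, b_X⁻¹, 0, 1)`
  let θ : ∀ X : ModelFrobenioid Φ₁ B₁ DivB₁, G₁.obj X ⟶ G₂.obj X := fun X =>
    { degFr := 1
      base := (b X).hom
      div := 1
      unit := 1
      rel := by rw [PNat.one_coe, pow_one, map_one, mul_one, map_one, mul_one]; exact hcls X }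
  let θ' : ∀ X : ModelFrobenioid Φ₁ B₁ DivB₁, G₂.obj X ⟶ G₁.obj X := fun X =>
    { degFr := 1
      base := (b X).inv
      div := 1
      unit := 1
      rel := by rw [PNat.one_coe, pow_one, map_one, mul_one, map_one, mul_one]; exact hcls' X }
  have hθθ' : ∀ X, θ X ≫ θ' X = 𝟙 (G₁.obj X) := fun X => by
    refine hom_ext (mul_one 1) (b X).hom_inv_id ?_ ?_
    · show (Φ₂.map (b X).hom.op).hom 1 * 1 ^ ((1 : ℕ+) : ℕ) = 1
      rw [map_one, one_pow, mul_one]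
    · show (B₂.map (b X).hom.op).hom 1 * 1 ^ ((1 : ℕ+) : ℕ) = 1
      rw [map_one, one_pow, mul_one]
  have hθ'θ : ∀ X, θ' X ≫ θ X = 𝟙 (G₂.obj X) := fun X => by
    refine hom_ext (mul_one 1) (b X).inv_hom_id ?_ ?_
    · show (Φ₂.map (b X).inv.op).hom 1 * 1 ^ ((1 : ℕ+) : ℕ) = 1
      rw [map_one, one_pow, mul_one]
    · show (B₂.map (b X).inv.op).hom 1 * 1 ^ ((1 : ℕ+) : ℕ) = 1
      rw [map_one, one_pow, mul_one]
  -- naturality: `(deg_Fr, Base, Div, u)` of `G₁ f ≫ θ_Y` and `θ_X ≫ G₂ f` agree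
  have hnat : ∀ {X Y : ModelFrobenioid Φ₁ B₁ DivB₁} (f : X ⟶ Y), G₁.map f ≫ θ Y = θ X ≫ G₂.map f := by
    intro X Y f
    refine hom_ext ?_ (hbn f) ?_ ?_
    · show (1 : ℕ+) * degFr (G₁.map f) = degFr (G₂.map f) * 1
      rw [hdeg₁, hdeg₂, one_mul, mul_one]
    · show (Φ₂.map (baseMap (G₁.map f)).op).hom 1 * div (G₁.map f) ^ ((1 : ℕ+) : ℕ) =
        (Φ₂.map (b X).hom.op).hom (div (G₂.map f)) * 1 ^ (degFr (G₂.map f) : ℕ)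
      rw [map_one, one_mul, PNat.one_coe, pow_one, one_pow, mul_one, hdiv]
      rfl
    · show (B₂.map (baseMap (G₁.map f)).op).hom 1 * unit (G₁.map f) ^ ((1 : ℕ+) : ℕ) =
        (B₂.map (b X).hom.op).hom (unit (G₂.map f)) * 1 ^ (degFr (G₂.map f) : ℕ)
      rw [map_one, one_mul, PNat.one_coe, pow_one, one_pow, mul_one, hunit]
      rfl
  refine ⟨NatIso.ofComponents (fun X => ⟨θ X, θ' X, hθθ' X, hθ'θ X⟩) (fun f => hnat f), fun X => ?_⟩
  exact ⟨rfl, rfl, rfl, rfl⟩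

/-- The same, as a bare existence statement: `G₁ ≅ G₂`. [cite: MochizukiFrdI2008, Thm. 5.2(iv) p.102] -/
theorem nonempty_iso_of_agree_unit : Nonempty (G₁ ≅ G₂) := by
  obtain ⟨ι, -⟩ := exists_iso_of_agree_unit a han b hbn hdeg₁ hdeg₂ hdiv hunit
  exact ⟨ι⟩

end Rigidity

section OverBaseIso

/-- **Two-functor rigidity, natural-isomorphism form**: `G₁`, `G₂` lying over the SAME base functor `H`
through `γ₁ : G₁ ⋙ Base ≅ Base ⋙ H`, `γ₂ : G₂ ⋙ Base ≅ Base ⋙ H` (the base identification being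
`b_X := γ₁ X ≫ (γ₂ X)⁻¹`), preserving Frobenius degrees and agreeing through `b` on divisors and units, are
isomorphic — "an isomorphism of Frobenioids lying over a given isomorphism of bases and inducing given maps
on the divisor and rational function monoids is unique up to isomorphism".
[cite: MochizukiFrdI2008, Thm. 5.2(iv) p.102] [cite: Mochizuki2012, Cor. 5.3 p.144] -/
theorem nonempty_iso_of_agree_unit_of_over
    (γ₁ : G₁ ⋙ baseFunctor Φ₂ B₂ DivB₂ ≅ baseFunctor Φ₁ B₁ DivB₁ ⋙ H)
    (γ₂ : G₂ ⋙ baseFunctor Φ₂ B₂ DivB₂ ≅ baseFunctor Φ₁ B₁ DivB₁ ⋙ H)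
    (hdeg₁ : ∀ ⦃X Y : ModelFrobenioid Φ₁ B₁ DivB₁⦄ (f : X ⟶ Y), degFr (G₁.map f) = degFr f)
    (hdeg₂ : ∀ ⦃X Y : ModelFrobenioid Φ₁ B₁ DivB₁⦄ (f : X ⟶ Y), degFr (G₂.map f) = degFr f)
    (hdiv : ∀ ⦃X Y : ModelFrobenioid Φ₁ B₁ DivB₁⦄ (f : X ⟶ Y),
      div (G₁.map f) = pull Φ₂ (γ₁.hom.app X ≫ γ₂.inv.app X : (G₁.obj X).base ⟶ (G₂.obj X).base)
        (div (G₂.map f)))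
    (hunit : ∀ ⦃X Y : ModelFrobenioid Φ₁ B₁ DivB₁⦄ (f : X ⟶ Y),
      unit (G₁.map f) = pull B₂ (γ₁.hom.app X ≫ γ₂.inv.app X : (G₁.obj X).base ⟶ (G₂.obj X).base)
        (unit (G₂.map f))) :
    Nonempty (G₁ ≅ G₂) :=
  nonempty_iso_of_agree_unit (fun X => γ₁.app X) (fun _ _ f => γ₁.hom.naturality f)
    (fun X => γ₁.app X ≪≫ (γ₂.app X).symm) (fun _ _ f => baseIdent_naturality γ₁ γ₂ f)
    hdeg₁ hdeg₂ hdiv hunit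

end OverBaseIso

end ModelFrobenioid

end Literature.AlgebraicGeometry.Frobenioids
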